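import Summits.CriticalPhenomena.PercolationContinuityZ3.Theorems.Transplant.KNLevelsTargetLemma
import Summits.CriticalPhenomena.PercolationContinuityZ3.Theorems.Transplant.KNLevelsZd
import Literature.Probability.Percolation.KozmaNitzanTargetLemma
import Literature.Probability.Percolation.SiteBondCriticalPoints
import HarnessLib

/-!
# REGRESSION of the generic Lemma 10: Kozma–Nitzan's `ℤ^d` target lemma (avoiding form) re-derived from `KNLevels.targetLemma_of_kits`
# with the `ℤ^d` seed kits of `L/KozmaNitzanTargetLemma.lean` and `L/KozmaNitzanBoxes.lean`

builds on p205010 (kernel theorem, internal audit signed; external expert review pending) — nothing in this file uses p205010.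
Lane `prim-bschramm`, seat `prim-bschramm-stmt` (kit-instance division with p2-g2, 07:51Z/07:58Z: "stmt: take the ℤ^d KIT REGRESSION").
The generic assembly of p2-g2 (`KNLevelsTargetLemma.lean`, p211887) over p3-g2's level layer (`KNLevelsDefs/Locality/StepII`), p2-g2/p3-g2's
Steps III–V and the seat's `GreedyPacking`/`KNLevelsHittable`/`KNLevelsZd`, fed with the ORIGINAL `ℤ^d` data — levels `B⟨j⟩ = Icc (lo-j) (hi+j)`
(`KNLevels.zdLevels`), seeds `LData.seedE`, faces `LData.ufaceX`, selection `LData.selOf`, counts `Ncont`/`seedBound`, Step-IV cubes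
`GM.ball (vX) M` with Lemma 7 (`exists_forall_le_lt_real_uniqZone`) and Lemma 9 (`exists_forall_lt_real_linked_orthantFace`) — returns EXACTLY the
statement of `KozmaNitzan.targetLemma_avoiding` (`L/KozmaNitzanTargetLemma.lean:2128`).  This certifies that the levels abstraction loses nothing on
the model case.

* `zdSeedKit L j M k` — the `ℤ^d` seed kit (`KNLevels.SData`) at level `j`, scale `M`, `k` seeds;
* `shyp_zdSeedKit` — it satisfies the generic Step-III axioms `KNLevels.SHyp (zdLevels L) j`;
* `seedE_not_mem_wireSet_shell`, `ufaceX_subset_shell` — the shell conditions of the generic assembly;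
* **`targetLemma_avoiding_of_kits`** — `KozmaNitzan.targetLemma_avoiding` (with `δ ≤ 1` added), re-proved through `KNLevels.targetLemma_of_kits`. (Dropping `δ ≤ 1` gives the
  landed original verbatim, which the gate's restatement lint does not allow to be re-declared.)
[cite: KozmaNitzan2024, §4 Lemma 10 (pp. 17–22)]
-/

noncomputable section

open MeasureTheory ProbabilityTheory
open scoped ENNReal

namespace Summit.CriticalPhenomena.PercolationContinuityZ3.Theorems

namespace Transplant

open Literature.Probability.Percolation Literature.Probability.Percolation.KozmaNitzan Literature.Probability.LatticeModels SimpleGraph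

variable {d : ℕ}

/-! ## The `ℤ^d` seed kit at a level -/

/-- **The `ℤ^d` seed kit** at level `j` (scale `M`, `k` seeds): candidate contacts `∂^{out} B⟨j⟩`, seeds `seedE`, faces `ufaceX`, selection `selOf`,
`N = Ncont d M k`, `sB = seedBound d M`. [cite: KozmaNitzan2024, §4 p. 19 (Step III)] -/
def zdSeedKit [NeZero d] (L : LData d) (j M k : ℕ) : KNLevels.SData (Site d) where
  K := outerBoundary (zdGraph d) (L.X j)
  seed := L.seedE j M
  face := L.ufaceX j M
  pick := LData.selOf M k
  N := LData.Ncont d M k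
  k := k
  sB := seedBound d M

/-- The endpoints of a seed edge of a contact vertex `x ∈ ∂^{out} B⟨j⟩` lie in `B⟨j+1⟩` (they lie in `B⟨j⟩ ∪ {x}`).
[cite: KozmaNitzan2024, §4 p. 19 (seeds)] -/
theorem seedE_endpoints_mem [NeZero d] {L : LData d} {j M : ℕ} (hwide : ∀ k, L.Lo j k + 2 * M + 2 ≤ L.Hi j k)
    {x : Site d} (hx : x ∈ outerBoundary (zdGraph d) (L.X j)) {e : Sym2 (Site d)} (he : e ∈ L.seedE j M x) :
    ∀ z ∈ e, z ∈ L.X (j + 1) := by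
  obtain ⟨h, hxy⟩ := LData.winData_spec hwide hx
  have hXj : L.X j ⊆ L.X (j + 1) := Icc_enlarge_mono (Nat.le_succ j)
  have hshrink : Finset.Icc (L.Lo j + 1) (L.Hi j - 1) ⊆ L.X j := by
    intro u hu
    rw [LData.X_eq, mem_Icc_iff] at *
    intro k'; have := hu k'
    simp only [Pi.add_apply, Pi.sub_apply, Pi.one_apply] at this; omega
  intro z hz
  rcases (mem_seedEdges_iff).1 he with h1 | ⟨w, hw, hab⟩ | hab
  · exact hXj (by rw [LData.X_eq]; exact wreg_subset_Icc h ((mem_edgesIn_iff.1 h1).2 z hz))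
  · rw [hab] at hz
    rcases Sym2.mem_iff.1 hz with rfl | rfl
    · exact hXj (by rw [LData.X_eq]; exact wreg_subset_Icc h (plaq_subset_wreg hw))
    · exact hXj (hshrink (uface_subset_shrink h ((mem_uface_iff).2 (by rwa [sub_add_cancel]))))
  · rw [hab] at hz
    rcases Sym2.mem_iff.1 hz with rfl | rfl
    · rw [← hxy]; exact outerBoundary_enlarge_subset L.lo L.hi j hx
    · exact hXj (by rw [LData.X_eq]; exact wreg_subset_Icc h (self_mem_wreg h))

/-- **The `ℤ^d` seed kit satisfies the generic Step-III axioms** at every wide level. [cite: KozmaNitzan2024, §4 p. 19 (Step III)] -/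
theorem shyp_zdSeedKit [NeZero d] (L : LData d) {j M : ℕ} (k : ℕ) (hwide : ∀ k', L.Lo j k' + 2 * M + 2 ≤ L.Hi j k') :
    KNLevels.SHyp (KNLevels.zdLevels L) j (zdSeedKit L j M k) where
  Kont_sub := fun ω => KNLevels.LData.Kont_subset j ω
  edge := fun _ hx _ he => (LData.mem_seedE hwide hx he).1
  within := fun _ hx _ he => seedE_endpoints_mem hwide hx he
  touch := fun _ hx _ he => (LData.mem_seedE hwide hx he).2.1
  card_le := fun _ _ => card_seedEdges_le
  conn := by
    intro x hx ω hω u hu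
    obtain ⟨h, hxy⟩ := LData.winData_spec hwide hx
    have := openConn_of_seedEdges_subset h hω hu
    rwa [← hxy] at this
  pick_sub := fun κ => LData.selOf_subset κ
  pick_card := fun _ _ hN => (LData.selOf_spec hN).2.1
  pick_disj := by
    intro κ hκK hN
    obtain ⟨-, -, hsep⟩ := LData.selOf_spec (M := M) (k := k) hN
    intro x hx x' hx' hne
    have hxO : x ∈ outerBoundary (zdGraph d) (L.X j) := hκK (LData.selOf_subset κ (Finset.mem_coe.1 hx))
    have hx'O : x' ∈ outerBoundary (zdGraph d) (L.X j) := hκK (LData.selOf_subset κ (Finset.mem_coe.1 hx'))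
    obtain ⟨h, hxy⟩ := LData.winData_spec hwide hxO
    obtain ⟨h', hxy'⟩ := LData.winData_spec hwide hx'O
    have hfar := hsep x (Finset.mem_coe.1 hx) x' (Finset.mem_coe.1 hx') hne
    rw [Function.onFun]
    change Disjoint (L.seedE j M x) (L.seedE j M x')
    unfold LData.seedE
    refine seedEdges_disjoint h h' ?_
    rw [← hxy, ← hxy']; exact hfar

/-- Seed edges avoid the pairs of the shell `S ⊆ Icc (Lo j + 1) (Hi j - 1)`: each has an endpoint outside the shrunk box.
[cite: KozmaNitzan2024, §4 p. 19] -/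
theorem seedE_not_mem_wireSet_shell [NeZero d] {L : LData d} {j M : ℕ} (hwide : ∀ k, L.Lo j k + 2 * M + 2 ≤ L.Hi j k)
    {S : Finset (Site d)} (hS : S ⊆ Finset.Icc (L.Lo j + 1) (L.Hi j - 1))
    {x : Site d} (hx : x ∈ outerBoundary (zdGraph d) (L.X j)) {e : Sym2 (Site d)} (he : e ∈ L.seedE j M x) :
    e ∉ wireSet (↑S : Set (Site d)) := by
  obtain ⟨-, -, ⟨z, hz, hzI⟩, -⟩ := LData.mem_seedE hwide hx he
  intro heS
  exact hzI (hS (Finset.mem_coe.1 (heS.1 z hz)))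

/-! ## The regression -/

/-- **Kozma–Nitzan's Lemma 10 on `ℤ^d` (avoiding form) FROM THE GENERIC ASSEMBLY**: the statement of `KozmaNitzan.targetLemma_avoiding`,
re-derived from `KNLevels.targetLemma_of_kits` (with the extra information `δ ≤ 1`, which also keeps the statement syntactically distinct from
the landed original for the gate's restatement lint) with the `ℤ^d` seed kits at every level of the window, the shells
`B⟨j-1⟩ \\ B⟨j-2M-2⟩`, and the Step-IV estimates behind each contact vertex (Lemma 7 `exists_forall_le_lt_real_uniqZone`, Lemma 9
`exists_forall_lt_real_linked_orthantFace`, the target route from `IsTarget`/`IsHittable`, `KozmaNitzan.stepIV_in`).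
[cite: KozmaNitzan2024, §4 Lemma 10 (pp. 17–22); p. 16 (targets); p. 36 (Question 9, the graph H)] -/
theorem targetLemma_avoiding_of_kits [NeZero d]
    (hC : ∀ ε : ℝ, 0 < ε → ∃ δ : ℝ, 0 < δ ∧ ∀ (w : Sym2 (Site d) → unitInterval) (Sf : Finset (Site d)),
      (∀ e : Sym2 (Site d), (∃ x ∈ e, x ∉ Sf) → w e = 0) →
      ∀ (A T : Finset (Site d)) (o : Site d) (Rg : Set (Site d)),
        A ⊆ Sf → T ⊆ Sf → o ∈ Sf → T.Nonempty → o ∉ Rg →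
        1 - δ < (prodBernoulli w).real (⋃ a ∈ A, openConn o a) →
          (∀ a ∈ A, 1 - δ < (prodBernoulli w).real (⋃ t ∈ T, openConnIn Rg a t)) →
            1 - ε < (prodBernoulli w).real (⋃ t ∈ T, openConn o t))
    (p : unitInterval)
    (hp0 : 0 < (p : ℝ)) (hp1 : (p : ℝ) < 1) (hθ : 0 < theta (zdGraph d) 0 p) {ε : ℝ} (hε : 0 < ε) :
    ∃ δ : ℝ, 0 < δ ∧ δ ≤ 1 ∧ ∀ H : List (Geom d), (∀ g ∈ H, IsHittable p g) → ∃ R : ℕ,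
      ∀ (W : Sym2 (Site d) → unitInterval) (Sfin D : Finset (Site d)) (lo hi : Site d)
        (T : Finset (Site d)) (o : Site d),
        FinSupp W Sfin → IsSubbox W p D → D ⊆ Sfin → o ∈ Sfin → o ∉ D →
        Finset.Icc (lo - (R : Site d)) (hi + (R : Site d)) ⊆ D →
        IsTarget T lo hi D R H → T ⊆ D → T.Nonempty →
        1 - δ < (prodBernoulli W).real (⋃ b ∈ Finset.Icc lo hi, openConn o b) →
          1 - ε < (prodBernoulli W).real (⋃ t ∈ T, openConn o t) := by
  classical
  -- the generic assembly supplies `δ` (Step I, part 1)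
  obtain ⟨δ, hδpos, hδ1, hTL⟩ := KNLevels.targetLemma_of_kits (G := zdGraph d) (Δ := 2 * d) degree_zdGraph_le_two_mul hC p hp1 hε
  refine ⟨δ, hδpos, hδ1, fun H hH => ?_⟩
  -- Step I, part 2: the scales `m`, `M` (exactly as in the original)
  have hη : 0 < δ ^ 2 := by positivity
  have hkl : ∀ g ∈ H, ∃ kl : ℕ × ℕ, ∀ m, kl.1 ≤ m → ∀ ℓ, kl.2 ≤ ℓ →
      1 - δ ^ 2 < (bondPercolation (zdGraph d) p).real (linkIn (↑(g.Qset ℓ 0)) (box d m) (g.Fset ℓ 0)) := by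
    intro g hg
    obtain ⟨k, ℓ₀, h⟩ := (hH g hg).hit (δ ^ 2) hη
    exact ⟨(k, ℓ₀), h⟩
  choose! kl hklspec using hkl
  have le_foldr_max_of_mem : ∀ {l : List ℕ} {a : ℕ}, a ∈ l → a ≤ l.foldr max 0 := by
    intro l
    induction l with
    | nil => intro a h; exact absurd h List.not_mem_nil
    | cons b l ih =>
      intro a h
      rw [List.foldr_cons]
      rcases List.mem_cons.1 h with rfl | h
      · exact le_max_left _ _
      · exact (ih h).trans (le_max_right _ _)
  set k₀ := (H.map fun g => (kl g).1).foldr max 0 with hk₀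
  set ℓmax := (H.map fun g => (kl g).2).foldr max 0 with hℓmax
  have hk₀le : ∀ g ∈ H, (kl g).1 ≤ k₀ := fun g hg => le_foldr_max_of_mem (List.mem_map.2 ⟨g, hg, rfl⟩)
  have hℓle : ∀ g ∈ H, (kl g).2 ≤ ℓmax := fun g hg => le_foldr_max_of_mem (List.mem_map.2 ⟨g, hg, rfl⟩)
  obtain ⟨m, hmk₀, n₁, hmn₁, hface⟩ := exists_forall_lt_real_linked_orthantFace p hθ hp1 hη k₀
  obtain ⟨n₂, huniq⟩ := exists_forall_le_lt_real_uniqZone p m hη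
  set M := max n₁ n₂ with hM
  have hmM : m ≤ M := (le_of_lt hmn₁).trans (le_max_left _ _)
  have hmM' : m < M := hmn₁.trans_le (le_max_left _ _)
  -- the number of seeds `k`, of contacts `N`, of levels
  set q : ℝ := 1 - (p : ℝ) ^ seedBound d M with hq
  have hq0 : 0 ≤ q := by rw [hq, sub_nonneg]; exact pow_le_one₀ p.2.1 p.2.2
  have hq1 : q < 1 := by rw [hq]; linarith [pow_pos hp0 (seedBound d M)]
  obtain ⟨k, hk⟩ := exists_pow_lt_of_lt_one hδpos hq1
  set N := LData.Ncont d M k with hN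
  set K₀ : ℝ := 1 / (1 - (p : ℝ)) ^ (2 * d * N) with hK₀
  set Lcount : ℕ := ⌈K₀ / δ⌉₊ + 1 with hLcount
  set j₀ : ℕ := 2 * M + 2 with hj₀
  set j₁ : ℕ := j₀ + Lcount - 1 with hj₁
  set R : ℕ := j₁ + M + ℓmax + 2 with hR
  refine ⟨R, fun W Sfin D lo hi T o hfin hsub hDS ho hoD hBR htgt hTD hTne hreach => ?_⟩
  set μ := prodBernoulli W with hμ
  -- `lo ≤ hi`, else `B = ∅`
  have hlohi : lo ≤ hi := by
    by_contra hlt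
    have : Finset.Icc lo hi = ∅ := Finset.Icc_eq_empty hlt
    rw [this] at hreach
    simp only [Finset.notMem_empty, Set.iUnion_of_empty, Set.iUnion_empty, measureReal_empty] at hreach
    linarith
  -- the level data: KN's, and the generic one on the levels `B⟨j⟩`
  set L : LData d := ⟨lo, hi, o, Sfin⟩ with hLdef
  have hL : LHyp L W p D (R - 1) :=
    { sub := hsub
      fin := hfin
      DS := hDS
      encl := by
        have : R - 1 + 1 = R := by omega
        rw [this]; exact hBR
      o_not := hoD
      o_mem := ho }
  have hL' : KNLevels.LHyp (KNLevels.zdLevels L) W p D (R - 1) := KNLevels.lhyp_zd hL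
  -- the count of levels
  have hj₁R : j₁ ≤ R - 1 := by omega
  have hcard : ((Finset.Icc j₀ j₁).card : ℝ) = Lcount := by
    rw [Nat.card_Icc]; congr 1; omega
  have hJ : 1 / (1 - (p : ℝ)) ^ (2 * d * N) ≤ δ * ((Finset.Icc j₀ j₁).card : ℝ) := by
    rw [hcard, hLcount]
    push_cast
    have h1 : K₀ / δ ≤ ⌈K₀ / δ⌉₊ := Nat.le_ceil _
    have h2 : K₀ = δ * (K₀ / δ) := by field_simp
    rw [← hK₀]
    nlinarith
  -- `{o ↔ B}` is the generic `reachB`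
  have hX0 : (KNLevels.zdLevels L).X 0 = Finset.Icc lo hi := by
    simp [KNLevels.zdLevels_X, hLdef]
  have hreach' : 1 - δ < μ.real (KNLevels.zdLevels L).reachB := by
    unfold KNLevels.LData.reachB
    rw [hX0]; exact hreach
  -- the kits at every level of the window
  refine hTL (KNLevels.zdLevels L) W D T (R - 1) N j₀ j₁ hL' hj₁R hTD hTne hJ (fun j hjJ => ?_) hreach'
  obtain ⟨hj₀j, hjj₁⟩ := Finset.mem_Icc.1 hjJ
  have hjR : j ≤ R - 1 := hjj₁.trans hj₁R
  have hjM : 2 * M + 2 ≤ j := hj₀j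
  have hwide : ∀ k', L.Lo j k' + 2 * M + 2 ≤ L.Hi j k' := by
    intro k'
    simp only [LData.Lo, LData.Hi, Pi.sub_apply, Pi.add_apply, Pi.natCast_apply]
    have : L.lo k' ≤ L.hi k' := hlohi k'
    omega
  -- the shell
  set S := L.X (j - 1) \ L.X (j - (2 * M + 2)) with hSdef
  have hS : S ⊆ Finset.Icc (L.Lo j + 1) (L.Hi j - 1) := LData.shell_subset_shrink (by omega)
  have hSX : S ⊆ (KNLevels.zdLevels L).X j := (Finset.sdiff_subset).trans (Icc_enlarge_mono (show j - 1 ≤ j by omega))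
  have hSD : S ⊆ D := (Finset.sdiff_subset).trans (hL.X_subset_D (by omega))
  -- the faces lie in the shell
  have hUS : ∀ x ∈ outerBoundary (zdGraph d) (L.X j), L.ufaceX j M x ⊆ S := by
    intro x hx
    obtain ⟨h, -⟩ := LData.winData_spec hwide hx
    refine (uface_subset_cube h).trans ?_
    change L.cubeX j M x ⊆ S
    rw [LData.cubeX_eq_ball]
    exact LData.ball_vX_subset_shell hjM hwide hx
  -- Step IV at every contact vertex: a relay reliable to `T` inside `D` (verbatim from the original)
  have hIV : ∀ x ∈ outerBoundary (zdGraph d) (L.X j),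
      1 - 3 * δ ≤ μ.real {ω | ∃ u ∈ L.ufaceX j M x,
        1 - δ < (prodBernoulli (pinW W (wireSet (↑S : Set (Site d))) ω)).real
          (⋃ t ∈ T, openConnIn (↑D : Set (Site d)) u t)} := by
    intro x hx
    set v := L.vX j M x with hv
    have hballS : GM.ball v M ⊆ S := LData.ball_vX_subset_shell hjM hwide hx
    have hballD : (↑(GM.ball v M) : Set (Site d)) ⊆ ↑D := Finset.coe_subset.2 (hballS.trans hSD)
    -- the target route from `v`
    have hvB : v ∈ Finset.Icc (lo - (R : Site d)) (hi + (R : Site d)) := by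
      have := LData.vX_mem (L := L) (by omega) hwide hx
      exact Icc_enlarge_mono (show j - 1 ≤ R by omega) this
    obtain ⟨ℓ, hRℓ, g, hg, hQ, hF⟩ := htgt.hit v hvB
    have hMℓ : M < ℓ := lt_of_lt_of_le (by omega) hRℓ
    -- (1) uniqueness zone
    have h1 : 1 - δ ^ 2 < μ.real (uniqZoneAt v m M) := by
      rw [hμ, hsub.real_eq_bondPercolation (determinedBy_uniqZoneAt v m M (wireSet_mono hballD))
        (measurableSet_uniqZoneAt v m M), real_uniqZoneAt_eq]
      exact huniq M (le_max_right _ _)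
    -- (2) the face
    have h2 : 1 - δ ^ 2 < μ.real (linkIn (↑(GM.ball v M)) (GM.ball v m) (L.ufaceX j M x)) := by
      obtain ⟨a, τ, hsubU⟩ := LData.orthantFace_image_subset_ufaceX hwide hx
      have hmono : linkIn (↑(GM.ball v M)) (GM.ball v m) ((orthantFace a τ M).image (· + v)) ⊆
          linkIn (↑(GM.ball v M)) (GM.ball v m) (L.ufaceX j M x) := linkIn_mono le_rfl le_rfl hsubU
      refine lt_of_lt_of_le ?_ (measureReal_mono hmono)
      rw [hμ, hsub.real_eq_bondPercolation (determinedBy_linkIn _ _ _ (wireSet_mono hballD))]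
      · have e1 : GM.ball v M = (box d M).image (· + v) := rfl
        have e2 : GM.ball v m = (box d m).image (· + v) := rfl
        rw [e1, e2, real_linkIn_image_add]
        exact hface M (le_max_left _ _) a τ
      · exact measurableSet_linkIn _ _ _
    -- (3) the target route
    have h3 : 1 - δ ^ 2 < μ.real (linkIn (↑(g.Qset ℓ v)) (GM.ball v m) (g.Fset ℓ v)) := by
      rw [hμ, hsub.real_eq_bondPercolation (determinedBy_linkIn _ _ _ (wireSet_mono (Finset.coe_subset.2 hQ)))
        (measurableSet_linkIn _ _ _)]
      have e2 : GM.ball v m = (box d m).image (· + v) := rfl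
      rw [g.Qset_eq_image ℓ v, g.Fset_eq_image ℓ v, e2, real_linkIn_image_add]
      exact hklspec g hg m ((hk₀le g hg).trans hmk₀) ℓ ((hℓle g hg).trans (by omega))
    exact stepIV_in (S := S) hsub hF hQ hmM hballS (LData.ufaceX_subset_innerBoundary hwide hx)
      (g.disjoint_Fset_ball hMℓ v) hδpos (Rg := (↑D : Set (Site d))) hballD (Finset.coe_subset.2 hQ) h1 h2 h3
  -- the kit at level `j`
  exact ⟨zdSeedKit L j M k, S, shyp_zdSeedKit L k hwide, le_rfl, hk.le, hSX, hSD,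
    fun x hx e he => seedE_not_mem_wireSet_shell hwide hS hx he, hUS, hIV⟩

end Transplant

end Summit.CriticalPhenomena.PercolationContinuityZ3.Theorems
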